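import Literature.RepresentationTheory.BorelWallach2000.U11TranslationOntoTheWallFromBelowBlock
import Literature.RepresentationTheory.BorelWallach2000.U11TranslationOffTheWallIndecomposable
import HarnessLib

/-!
# Consequences of (5.10)″ `θ↑_on θ↓_off ≅ Id ⊕ Id`: `Hom_R(θ↓_off A, θ↓_off B) ≅ Hom_R(A,B)²`, and `θ↓_off S` is indecomposable with
# `End_R(θ↓_off S) = ℂ[C − c″]/((C − c″)²)` for every irreducible `S` of the wall block

Family `hodge`, lane `lit-hodgefound` (foundations library; seat `lit-hodgefound-p39`, generation 29, row g29-#17); topic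
`RepresentationTheory/BorelWallach2000`, namespace `…BorelWallach2000.U11TranslWallNat` (continued).  The mirror image, for the translation
`θ↓_off = ψ^{χ(a,a−2)}_{F_{1,−1}}` off the wall DOWNWARDS, of g29-#3 §2–§3 (`U11TranslationOntoTheWallConsequences`: `Hom` doubling,
`dim End_R(θ_off S) = 2`) and of g29-#16 (`U11TranslationOffTheWallIndecomposable`: `θ_off S` indecomposable), obtained from g29-#13's natural
isomorphism `wallFromBelowNatEquiv : A ⊕ A ≃ θ↑_on θ↓_off A` through the adjunction `Hom(ψ_{F_{1,−1}} A, V) ≅ Hom(A, ψ_{F_{1,0}} V)`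
(`U11TranslAdj.translAdjoint` at `(m,n,n′) = (1,−1,0)`; KV Prop. 7.143, Mazorchuk Lemma 5.87) and g29-#16's two-dimensional-algebra lemmas with
g29-#12's non-zero nilpotent `C − c″` on `θ↓_off S`.  Theorems and one definition with body; 0 `sorry`, no named fact (net debt 0, D-0026).

## The sources, verbatim

* V. Mazorchuk, *Lectures on `𝔰𝔩₂(ℂ)`-modules* (2009) [Mazorchuk2009] (galaxy book panama:449511277199416, pp. 91, 139–141): Lemma 5.87 («the
  functor `θ_i^{i+1}` is both left and right adjoint to the functor `θ_{i+1}^i`»), Prop. 5.90 (5.10), Exercise 3.111 (d), Exercise 5.92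
  («`θ_{−1}^0 M(−1) ≅ P(−2)`»), Lemma 5.93 (proof: «… `= P(−2)`, which is indecomposable»).
* A. W. Knapp, D. A. Vogan, *Cohomological Induction and Unitary Representations* (1995) [KnappVogan1995], §VII.8 Thm. 7.133, Prop. 7.143;
  Cor. 7.207; App. A Prop. A.12.

## What is formalised

§1 `homTranslDownEquivWall` (`Hom_R(θ↓_off A, θ↓_off B) ≃ₗ[ℂ] Hom_R(A,B) × Hom_R(A,B)`, `B` of finite length), `finrank_hom_translDown_wall`,
`finiteDimensional_hom_translDown_wall`; §2 for an irreducible `S` of the wall block: **`finrank_end_translDown_of_simple`** (`= 2`),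
`not_isSimpleModule_translDown_of_simple`, `nontrivial_end_translDown_of_simple`, **`end_translDown_eq_smul_one_add_smul_of_simple`**,
**`subCasimirGK_mul_self_eq_zero_translDown_of_simple`** (`(C − c″)² = 0`), **`eq_bot_or_eq_top_of_isCompl_translDown_of_simple`** (`θ↓_off S`
indecomposable).  NOT here: functor-level indecomposability; nothing here is a case of the Hodge conjecture.

Consumed by name: g29-#13 `wallFromBelowNatEquiv`; g29-#12 `subCasimirGK_translDown_ne_zero`, `translDown_ne_bot_of_simple`; g29-#16
`exists_eq_smul_one_add_smul`, `mul_self_eq_zero_of_finrank_two`, `eq_zero_or_eq_one_of_isIdempotentElem`; g29-#3 `finrank_end_of_simple`,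
`isFiniteLength_of_simple`; g29-#1 `isNilpotent_subCasimirGK`; `U11TranslAdj.translAdjoint`; `GKHom.postCompEquiv`; `U11HC.finiteDimensional_hom`;
`U11Transl.hasGenInfChar_transl`; Mathlib `LinearMap.prodEquiv`, `Module.finrank_prod`, `Submodule.projection`, `isIdempotentElem_projection`.

## References

* V. Mazorchuk, *Lectures on `𝔰𝔩₂(ℂ)`-modules*, Imperial College Press (2009), §5.8 Lemma 5.87, Prop. 5.90 (5.10), Exercise 5.92, Lemma 5.93;
  §3.13 Exercise 3.111 (galaxy panama:449511277199416, pp. 91, 139–141). [Mazorchuk2009]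
* A. W. Knapp, D. A. Vogan, *Cohomological Induction and Unitary Representations*, Princeton Math. Ser. 45 (1995), §VII.8 Thm. 7.133,
  Prop. 7.143; §VII.13 Cor. 7.207; App. A Prop. A.12. [KnappVogan1995]
-/

noncomputable section

open scoped Matrix ComplexConjugate TensorProduct
open Polynomial

namespace Literature.RepresentationTheory.BorelWallach2000

open Literature.Algebra.Lie Literature.Algebra.Lie.ChevalleyEilenberg
open Literature.NumberTheory.Automorphic
open Literature.RepresentationTheory.KonnoKonno2007 Literature.RepresentationTheory.KonnoKonno2007.RealDualPair
open Literature.RepresentationTheory.KonnoKonno2007.RealDualPair.UForm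
open U11HolDS

-- carriers `↥W` over `GKRing G11` with their `ℂ`-structures (as in `GKModuleRing` §7–§8)
set_option maxSynthPendingDepth 4

namespace U11TranslWallNat

open U11FinRep (Fm kAct lieAct)
open U11Transl (tensorFin transl translMap translEquiv isGKModule_tensorFin isGKModule_transl)
open U11Primary (HasGenInfChar)
open U11TranslAdj (translAdjoint)
open U11TranslDS (zScalarDS cScalarDS)
open U11TranslPSNonsplit (subCasimirGK)

/-! ## §1 `Hom_R(θ↓_off A, θ↓_off B) ≅ Hom_R(A, B) ⊕ Hom_R(A, B)`: translation off the wall DOWNWARDS doubles `Hom` spaces -/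

section Hom

universe u

variable (a b : ℤ)
variable {A : Type u} [AddCommGroup A] [Module ℂ A] [Module (GKRing G11) A] [IsScalarTower ℂ (GKRing G11) A]
  (hA : IsGKModule G11 (GKRing.actK G11 A) (GKRing.actLie G11 A))
  (hAχ : HasGenInfChar (GKRing.actLie G11 A) (zScalarDS a b) (cScalarDS a b))
variable {B : Type u} [AddCommGroup B] [Module ℂ B] [Module (GKRing G11) B] [IsScalarTower ℂ (GKRing G11) B]
  (hB : IsGKModule G11 (GKRing.actK G11 B) (GKRing.actLie G11 B))
  (hBχ : HasGenInfChar (GKRing.actLie G11 B) (zScalarDS a b) (cScalarDS a b))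

/-- **`Hom_R(θ↓_off A, θ↓_off B) ≃ₗ[ℂ] Hom_R(A, B) × Hom_R(A, B)`** for `A`, `B` in the wall block, `B` of finite length: the adjunction
`Hom(ψ_{F_{1,−1}} A, V) ≅ Hom(A, ψ_{F_{1,0}} V)` (KV Prop. 7.143 with `(F_{1,−1})* = F_{1,0}`; Lemma 5.87), then (5.10)″ `θ↑_on θ↓_off B ≅ B ⊕ B`
(g29-#13 `wallFromBelowNatEquiv`) and `Hom(A, B ⊕ B) ≅ Hom(A, B)²`. [cite: Mazorchuk2009, Lemma 5.87, Prop. 5.90 (5.10)] [cite: KnappVogan1995, §VII.8 Prop. 7.143] -/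
def homTranslDownEquivWall (h : a - b = 1) (hflB : IsFiniteLength (GKRing G11) B) :
    (transl hA 1 (-1) (zScalarDS a (b - 1)) (cScalarDS a (b - 1)) →ₗ[GKRing G11] transl hB 1 (-1) (zScalarDS a (b - 1)) (cScalarDS a (b - 1))) ≃ₗ[ℂ]
      ((A →ₗ[GKRing G11] B) × (A →ₗ[GKRing G11] B)) :=
  (translAdjoint hA (isGKModule_transl hB 1 (-1) (zScalarDS a (b - 1)) (cScalarDS a (b - 1))) 1 (-1) (n' := 0) (by norm_num) hAχ
      (U11Transl.hasGenInfChar_transl hB hBχ.isZCFinite 1 (-1) (zScalarDS a (b - 1)) (cScalarDS a (b - 1)))).trans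
    ((GKHom.postCompEquiv G11 (M := A) (wallFromBelowNatEquiv a b hB hBχ h hflB).symm).trans (LinearMap.prodEquiv (S := ℂ)).symm)

include hAχ hBχ in
/-- **`dim Hom_R(θ↓_off A, θ↓_off B) = 2 · dim Hom_R(A, B)`** for finite-length `A`, `B` of the wall block. [cite: Mazorchuk2009, Prop. 5.90 (5.10), Lemma 5.87]
[cite: KnappVogan1995, §VII.8 Prop. 7.143, Cor. 7.207] -/
theorem finrank_hom_translDown_wall (h : a - b = 1) (hflA : IsFiniteLength (GKRing G11) A) (hflB : IsFiniteLength (GKRing G11) B) :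
    Module.finrank ℂ (transl hA 1 (-1) (zScalarDS a (b - 1)) (cScalarDS a (b - 1)) →ₗ[GKRing G11]
        transl hB 1 (-1) (zScalarDS a (b - 1)) (cScalarDS a (b - 1))) = 2 * Module.finrank ℂ (A →ₗ[GKRing G11] B) := by
  haveI := U11HC.finiteDimensional_hom hA hB hflA hflB
  rw [(homTranslDownEquivWall a b hA hAχ hB hBχ h hflB).finrank_eq, Module.finrank_prod, two_mul]

include hA hB hAχ hBχ in
/-- `Hom_R(θ↓_off A, θ↓_off B)` is finite-dimensional for finite-length `A`, `B` of the wall block. [cite: KnappVogan1995, Cor. 7.207, Prop. A.12] -/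
theorem finiteDimensional_hom_translDown_wall (h : a - b = 1) (hflA : IsFiniteLength (GKRing G11) A) (hflB : IsFiniteLength (GKRing G11) B) :
    FiniteDimensional ℂ (transl hA 1 (-1) (zScalarDS a (b - 1)) (cScalarDS a (b - 1)) →ₗ[GKRing G11]
      transl hB 1 (-1) (zScalarDS a (b - 1)) (cScalarDS a (b - 1))) := by
  haveI := U11HC.finiteDimensional_hom hA hB hflA hflB
  exact LinearEquiv.finiteDimensional (homTranslDownEquivWall a b hA hAχ hB hBχ h hflB).symm

end Hom

/-! ## §2 `θ↓_off S` for an irreducible `S`: `dim End = 2`, not irreducible, `End = ℂ·1 ⊕ ℂ·(C − c″)`, `(C − c″)² = 0`, indecomposable -/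

section EndSimple

universe u

variable (a b : ℤ)
variable {S : Type u} [AddCommGroup S] [Module ℂ S] [Module (GKRing G11) S] [IsScalarTower ℂ (GKRing G11) S]
  (hS : IsGKModule G11 (GKRing.actK G11 S) (GKRing.actLie G11 S))
  (hSχ : HasGenInfChar (GKRing.actLie G11 S) (zScalarDS a b) (cScalarDS a b))

include hSχ in
/-- **`dim_ℂ End_R(θ↓_off S) = 2` for every irreducible `S` of the wall block.** [cite: Mazorchuk2009, Prop. 5.90 (5.10), Exercise 3.111 (d)]
[cite: KnappVogan1995, §VII.8 Prop. 7.143] -/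
theorem finrank_end_translDown_of_simple (h : a - b = 1) [IsSimpleModule (GKRing G11) S] :
    Module.finrank ℂ (transl hS 1 (-1) (zScalarDS a (b - 1)) (cScalarDS a (b - 1)) →ₗ[GKRing G11]
      transl hS 1 (-1) (zScalarDS a (b - 1)) (cScalarDS a (b - 1))) = 2 := by
  rw [finrank_hom_translDown_wall a b hS hSχ hS hSχ h isFiniteLength_of_simple isFiniteLength_of_simple, finrank_end_of_simple hS, mul_one]

include hSχ in
/-- **`θ↓_off S` is NOT irreducible** (nor zero, g29-#12 `translDown_ne_bot_of_simple`) for an irreducible `S` of the wall block.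
[cite: KnappVogan1995, §VII.8 Thm. 7.133, contrast Thm. 7.229] [cite: Mazorchuk2009, Exercise 3.111] -/
theorem not_isSimpleModule_translDown_of_simple (h : a - b = 1) [IsSimpleModule (GKRing G11) S] :
    ¬ IsSimpleModule (GKRing G11) (transl hS 1 (-1) (zScalarDS a (b - 1)) (cScalarDS a (b - 1))) := fun hs => by
  haveI := hs
  have h2 := finrank_end_translDown_of_simple a b hS hSχ h
  rw [finrank_end_of_simple (isGKModule_transl hS 1 (-1) (zScalarDS a (b - 1)) (cScalarDS a (b - 1)))] at h2
  exact absurd h2 (by norm_num)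

include hSχ in
/-- `End_R(θ↓_off S)` is a nontrivial ring (`θ↓_off S ≠ 0`). [cite: Mazorchuk2009, Lemma 5.93 (proof)] -/
theorem nontrivial_end_translDown_of_simple (h : a - b = 1) [IsSimpleModule (GKRing G11) S] :
    Nontrivial (Module.End (GKRing G11) (transl hS 1 (-1) (zScalarDS a (b - 1)) (cScalarDS a (b - 1)))) := by
  haveI : Nontrivial (transl hS 1 (-1) (zScalarDS a (b - 1)) (cScalarDS a (b - 1))) :=
    (Submodule.nontrivial_iff_ne_bot).mpr (translDown_ne_bot_of_simple a b hS hSχ h)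
  infer_instance

include hSχ in
/-- **Every endomorphism of `θ↓_off S` is `s·1 + t·(C − c″)`**, `c″ = cScalarDS a (b−1)` (g29-#16's two-dimensional-algebra lemma with g29-#12's
`C − c″ ≠ 0` nilpotent). [cite: Mazorchuk2009, Exercise 3.111 (d), Exercise 5.92] [cite: KnappVogan1995, §VII.8 Prop. 7.143] -/
theorem end_translDown_eq_smul_one_add_smul_of_simple (h : a - b = 1) [IsSimpleModule (GKRing G11) S]
    (f : Module.End (GKRing G11) (transl hS 1 (-1) (zScalarDS a (b - 1)) (cScalarDS a (b - 1)))) :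
    ∃ s t : ℂ, f = s • 1 + t • subCasimirGK (isGKModule_transl hS 1 (-1) (zScalarDS a (b - 1)) (cScalarDS a (b - 1))) (cScalarDS a (b - 1)) := by
  haveI := nontrivial_end_translDown_of_simple a b hS hSχ h
  exact exists_eq_smul_one_add_smul (K := ℂ)
    (isNilpotent_subCasimirGK _ (U11Transl.hasGenInfChar_transl hS hSχ.isZCFinite 1 (-1) (zScalarDS a (b - 1)) (cScalarDS a (b - 1))))
    (subCasimirGK_translDown_ne_zero a b hS hSχ h) (finrank_end_translDown_of_simple a b hS hSχ h) f

include hSχ in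
/-- **`(C − c″)² = 0` on `θ↓_off S`**. [cite: Mazorchuk2009, Exercise 3.111 (d), Exercise 5.92] -/
theorem subCasimirGK_mul_self_eq_zero_translDown_of_simple (h : a - b = 1) [IsSimpleModule (GKRing G11) S] :
    subCasimirGK (isGKModule_transl hS 1 (-1) (zScalarDS a (b - 1)) (cScalarDS a (b - 1))) (cScalarDS a (b - 1)) *
      subCasimirGK (isGKModule_transl hS 1 (-1) (zScalarDS a (b - 1)) (cScalarDS a (b - 1))) (cScalarDS a (b - 1)) = 0 := by
  haveI := nontrivial_end_translDown_of_simple a b hS hSχ h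
  exact mul_self_eq_zero_of_finrank_two (K := ℂ)
    (isNilpotent_subCasimirGK _ (U11Transl.hasGenInfChar_transl hS hSχ.isZCFinite 1 (-1) (zScalarDS a (b - 1)) (cScalarDS a (b - 1))))
    (subCasimirGK_translDown_ne_zero a b hS hSχ h) (finrank_end_translDown_of_simple a b hS hSχ h)

include hSχ in
/-- **`θ↓_off S` IS INDECOMPOSABLE** for every irreducible `S` of the wall block: `θ↓_off S = U ⊕ V ⟹ U = 0 ∨ U = θ↓_off S`.
[cite: Mazorchuk2009, Exercise 5.92, Lemma 5.93] -/
theorem eq_bot_or_eq_top_of_isCompl_translDown_of_simple (h : a - b = 1) [IsSimpleModule (GKRing G11) S]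
    (U V : Submodule (GKRing G11) (transl hS 1 (-1) (zScalarDS a (b - 1)) (cScalarDS a (b - 1)))) (hUV : IsCompl U V) : U = ⊥ ∨ U = ⊤ := by
  haveI := nontrivial_end_translDown_of_simple a b hS hSχ h
  rcases eq_zero_or_eq_one_of_isIdempotentElem (K := ℂ)
      (isNilpotent_subCasimirGK _ (U11Transl.hasGenInfChar_transl hS hSχ.isZCFinite 1 (-1) (zScalarDS a (b - 1)) (cScalarDS a (b - 1))))
      (subCasimirGK_translDown_ne_zero a b hS hSχ h) (finrank_end_translDown_of_simple a b hS hSχ h)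
      (Submodule.isIdempotentElem_projection hUV) with h0 | h1
  · left
    refine (Submodule.eq_bot_iff U).mpr fun u hu => ?_
    have hu' : U.projection V hUV ((⟨u, hu⟩ : U) : transl hS 1 (-1) (zScalarDS a (b - 1)) (cScalarDS a (b - 1))) = 0 :=
      LinearMap.congr_fun h0 _
    rw [Submodule.projection_apply_left] at hu'
    exact hu'
  · right
    have hV : V = ⊥ := by
      refine (Submodule.eq_bot_iff V).mpr fun v hv => ?_
      have hv' : U.projection V hUV ((⟨v, hv⟩ : V) : transl hS 1 (-1) (zScalarDS a (b - 1)) (cScalarDS a (b - 1))) =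
          ((⟨v, hv⟩ : V) : transl hS 1 (-1) (zScalarDS a (b - 1)) (cScalarDS a (b - 1))) := LinearMap.congr_fun h1 _
      rw [Submodule.projection_apply_right] at hv'
      exact hv'.symm
    rw [← hUV.sup_eq_top, hV, sup_bot_eq]

end EndSimple

end U11TranslWallNat

end Literature.RepresentationTheory.BorelWallach2000
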